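import Mathlib
import HarnessLib
import Summits.Ventures.LatticeQCDFlow.Scaling.EntropyLagLaw

/-!
# EntropyLagLawAnyGrid — the relative-entropy lag law on ANY monotone grid with steps `≤ δ̄`:
# `|⟨W⟩ − ΔF − KL_qs| ≤ KL_qs + (κ/(1−κ))·n·Λ̄(2δ̄(1−κ)/κ)` (registry lever `protocol.schedule`)

HONEST FRAMING: exact (Metropolis-corrected) sampling algorithms for lattice gauge theory;
figures of merit are autocorrelation/cost numbers at stated couplings and volumes; no
continuum-physics claim.

Venture `LatticeQCDFlow` (cell pub-lqcd), topic `Scaling`; FANOUT row 19 (`su2-snf`, GEN-9).  OUR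
WORK; nothing is cited as a fact.  `Scaling/EntropyLagLaw` states the entropy route on the UNIFORM grid;
the registry's `protocol.schedule = power` and gen-6's any-grid files (`WorkExponentialMomentsAnyGrid`,
`GeneralLayerESSFloorAnyGrid`) ask for non-uniform spacings.  The entropy recursion tolerates them at no
cost: with steps `0 ≤ c_{j+1} − c_j ≤ δ̄` the per-step term `(c_{j+1} − c_j)·lag_j` is dominated using
`lag_j ≤ (KL(μ_j‖π_j) + Λ)/λ ≥ 0`-type bounds with `δ̄` in place of the step, and everything else is
the uniform proof with `δ ↦ δ̄` (`n` = number of steps).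

* `klFin_evolveLaw_succ_le_step` — the entropy recursion with the actual step `c_{j+1} − c_j`;
* **`abs_layerDissipation_sub_qs_le_entropy_anyGrid`** (general `λ`, LEVEL-DEPENDENT `Λ_j ≥ 0`):
  `|⟨W⟩ − ΔF − KL_qs| ≤ (δ̄/λ)·((1−κ)(KL_qs + (δ̄/λ)ΣΛ_j)/(1 − r) + ΣΛ_j)`, `r = (1−κ)(1 + δ̄/λ) < 1`
  (plug MEASURED per-level log-MGFs);
* **`abs_layerDissipation_sub_qs_le_entropy_anyGrid'`** (the choice `λ = 2δ̄(1−κ)/κ`, `0 < κ < 1`):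
  `|⟨W⟩ − ΔF − KL_qs| ≤ KL_qs + (κ/(1−κ))·n·Λ`.

NOT CLAIMED: the optimal schedule (the sum form is the tool for it; no optimisation here).
-/

namespace Summit.Ventures.LatticeQCDFlow.Scaling

open Finset
open Literature.Probability.MarkovChains (IsRowStochastic stepLaw stepLaw_nonneg sum_stepLaw)
open Summit.Ventures.LatticeQCDFlow.Exactness
open Summit.Ventures.LatticeQCDFlow.Theory2

variable {X : Type*} [Fintype X]

section Law

variable [Nonempty X] (S₀ D : X → ℝ) (c : ℕ → ℝ) (P : ℕ → X → X → ℝ)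

/-- **THE ENTROPY RECURSION, any grid.**  With entropy contraction `κ` of `P_j` towards `π_{j+1}`:
`KL(μ_{j+1} ‖ π_{j+1}) ≤ (1 − κ)·(KL(μ_j ‖ π_j) + (c_{j+1} − c_j)·lag_j + KL(π_j ‖ π_{j+1}))`. [ours] -/
theorem klFin_evolveLaw_succ_le_step (hP : ∀ k, IsRowStochastic (P k)) {κ : ℝ}
    (hK : ∀ k (μ : X → ℝ), (∀ x, 0 ≤ μ x) → ∑ x, μ x = 1 →
      klFin (stepLaw (P k) μ) (gibbsLaw (linAction S₀ D (c (k + 1))))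
        ≤ (1 - κ) * klFin μ (gibbsLaw (linAction S₀ D (c (k + 1))))) (j : ℕ) :
    klFin (evolveLaw P (gibbsLaw (linAction S₀ D (c 0))) (j + 1))
        (gibbsLaw (linAction S₀ D (c (j + 1))))
      ≤ (1 - κ) * (klFin (evolveLaw P (gibbsLaw (linAction S₀ D (c 0))) j)
            (gibbsLaw (linAction S₀ D (c j)))
          + (c (j + 1) - c j) * layerLag S₀ D c P j
          + klFin (gibbsLaw (linAction S₀ D (c j))) (gibbsLaw (linAction S₀ D (c (j + 1))))) := by
  have hμ0 := evolveLaw_nonneg S₀ D c P hP j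
  have hμ1 := sum_evolveLaw_gibbs S₀ D c P hP j
  rw [evolveLaw_succ]
  refine (hK j _ hμ0 hμ1).trans (le_of_eq ?_)
  rw [klFin_changeRef_linAction S₀ D (c j) (c (j + 1)) hμ0 hμ1]
  rfl

/-- **THE ENTROPY LAG LAW ON ANY MONOTONE GRID, general `λ`.**  Row-stochastic layers with entropy
contraction `0 < κ ≤ 1` towards their targets, grid steps `0 ≤ c_{k+1} − c_k ≤ δ̄` (`δ̄ > 0`),
LEVEL-DEPENDENT log-MGF envelopes `Λ_j ≥ 0` at `±λ` (`λ > 0`) for `j < n`, and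
`r = (1 − κ)(1 + δ̄/λ) < 1`.  Then for every `n`:
`|⟨W⟩ − ΔF − KL_qs| ≤ (δ̄/λ)·((1 − κ)(KL_qs + (δ̄/λ)Σ_{j<n}Λ_j)/(1 − r) + Σ_{j<n}Λ_j)`. [ours] -/
theorem abs_layerDissipation_sub_qs_le_entropy_anyGrid (hP : ∀ k, IsRowStochastic (P k)) {δ : ℝ}
    (hδ : 0 < δ) (hc0 : ∀ k, 0 ≤ c (k + 1) - c k) (hc : ∀ k, c (k + 1) - c k ≤ δ) {κ : ℝ}
    (hκ1 : κ ≤ 1)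
    (hK : ∀ k (μ : X → ℝ), (∀ x, 0 ≤ μ x) → ∑ x, μ x = 1 →
      klFin (stepLaw (P k) μ) (gibbsLaw (linAction S₀ D (c (k + 1))))
        ≤ (1 - κ) * klFin μ (gibbsLaw (linAction S₀ D (c (k + 1)))))
    {lam : ℝ} {Λ : ℕ → ℝ} (hlam : 0 < lam) (hΛ0 : ∀ j, 0 ≤ Λ j)
    (hr : (1 - κ) * (1 + δ / lam) < 1) (n : ℕ)
    (hΛp : ∀ j, j < n → Real.log (∑ y, gibbsLaw (linAction S₀ D (c j)) y
        * Real.exp (lam * (D y - meanD S₀ D (c j)))) ≤ Λ j)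
    (hΛm : ∀ j, j < n → Real.log (∑ y, gibbsLaw (linAction S₀ D (c j)) y
        * Real.exp (-lam * (D y - meanD S₀ D (c j)))) ≤ Λ j) :
    |layerDissipation S₀ D c P n - qsDissipation S₀ D c n|
      ≤ (δ / lam) * ((1 - κ) * (qsDissipation S₀ D c n + (δ / lam) * ∑ j ∈ range n, Λ j)
            / (1 - (1 - κ) * (1 + δ / lam)) + ∑ j ∈ range n, Λ j) := by
  -- notation
  set a : ℕ → ℝ := fun j => klFin (evolveLaw P (gibbsLaw (linAction S₀ D (c 0))) j)
    (gibbsLaw (linAction S₀ D (c j))) with ha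
  set q : ℕ → ℝ := fun j => klFin (gibbsLaw (linAction S₀ D (c j)))
    (gibbsLaw (linAction S₀ D (c (j + 1)))) with hq
  set u := δ / lam with hu
  have hu0 : 0 < u := div_pos hδ hlam
  have hκ' : 0 ≤ 1 - κ := sub_nonneg.2 hκ1
  -- the per-step facts
  have han : ∀ j, 0 ≤ a j := fun j =>
    klFin_nonneg (evolveLaw_nonneg S₀ D c P hP j) (gibbsLaw_pos _)
      (by rw [sum_evolveLaw_gibbs S₀ D c P hP j, sum_gibbsLaw])
  have ha0 : a 0 = 0 := by
    simp only [ha, evolveLaw_zero]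
    exact klFin_self (gibbsLaw_pos _)
  have hlag : ∀ j, j < n → |layerLag S₀ D c P j| ≤ (a j + Λ j) / lam := fun j hj =>
    abs_layerLag_le_entropy S₀ D c P hP hlam j (hΛp j hj) (hΛm j hj)
  have hrec : ∀ j, j < n → a (j + 1) ≤ (1 - κ) * (1 + u) * a j + (1 - κ) * (q j + u * Λ j) := by
    intro j hj
    have h1 := klFin_evolveLaw_succ_le_step S₀ D c P hP hK j
    have haΛ : 0 ≤ (a j + Λ j) / lam := div_nonneg (add_nonneg (han j) (hΛ0 j)) hlam.le
    have h2 : (c (j + 1) - c j) * layerLag S₀ D c P j ≤ u * (a j + Λ j) := by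
      have hl := (abs_le.1 (hlag j hj)).2
      calc (c (j + 1) - c j) * layerLag S₀ D c P j ≤ (c (j + 1) - c j) * ((a j + Λ j) / lam) :=
            mul_le_mul_of_nonneg_left hl (hc0 j)
        _ ≤ δ * ((a j + Λ j) / lam) := mul_le_mul_of_nonneg_right (hc j) haΛ
        _ = u * (a j + Λ j) := by rw [hu]; ring
    calc a (j + 1) ≤ (1 - κ) * (a j + (c (j + 1) - c j) * layerLag S₀ D c P j + q j) := h1
      _ ≤ (1 - κ) * (a j + u * (a j + Λ j) + q j) := by
          apply mul_le_mul_of_nonneg_left _ hκ'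
          linarith
      _ = (1 - κ) * (1 + u) * a j + (1 - κ) * (q j + u * Λ j) := by ring
  -- sum of the entropies
  have hsumA : ∑ j ∈ range n, a j
      ≤ (∑ j ∈ range n, (1 - κ) * (q j + u * Λ j)) / (1 - (1 - κ) * (1 + u)) :=
    sum_range_le_of_rec hr ha0 han n hrec
  have hsumq : ∑ j ∈ range n, q j = qsDissipation S₀ D c n :=
    (qsDissipation_eq_sum_klFin S₀ D c n).symm
  have hsums : ∑ j ∈ range n, (1 - κ) * (q j + u * Λ j)
      = (1 - κ) * (qsDissipation S₀ D c n + u * ∑ j ∈ range n, Λ j) := by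
    rw [← mul_sum, sum_add_distrib, hsumq, ← mul_sum]
  rw [hsums] at hsumA
  -- the lag sum
  have hdiss : layerDissipation S₀ D c P n - qsDissipation S₀ D c n
      = ∑ j ∈ range n, (c (j + 1) - c j) * layerLag S₀ D c P j := by
    rw [layerDissipation_eq S₀ D c P (fun k => (hP k).2) n, add_sub_cancel_left]
  rw [hdiss]
  calc |∑ j ∈ range n, (c (j + 1) - c j) * layerLag S₀ D c P j|
      ≤ ∑ j ∈ range n, |(c (j + 1) - c j) * layerLag S₀ D c P j| := abs_sum_le_sum_abs _ _
    _ ≤ ∑ j ∈ range n, u * (a j + Λ j) := by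
        refine sum_le_sum fun j hj => ?_
        have hjn := mem_range.1 hj
        have haΛ : 0 ≤ (a j + Λ j) / lam := div_nonneg (add_nonneg (han j) (hΛ0 j)) hlam.le
        rw [abs_mul, abs_of_nonneg (hc0 j)]
        calc (c (j + 1) - c j) * |layerLag S₀ D c P j| ≤ (c (j + 1) - c j) * ((a j + Λ j) / lam) :=
              mul_le_mul_of_nonneg_left (hlag j hjn) (hc0 j)
          _ ≤ δ * ((a j + Λ j) / lam) := mul_le_mul_of_nonneg_right (hc j) haΛ
          _ = u * (a j + Λ j) := by rw [hu]; ring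
    _ = u * (∑ j ∈ range n, a j + ∑ j ∈ range n, Λ j) := by
        rw [← mul_sum, sum_add_distrib]
    _ ≤ u * ((1 - κ) * (qsDissipation S₀ D c n + u * ∑ j ∈ range n, Λ j)
          / (1 - (1 - κ) * (1 + u)) + ∑ j ∈ range n, Λ j) := by
        apply mul_le_mul_of_nonneg_left _ hu0.le
        linarith

/-- **THE ANY-GRID ENTROPY LAG LAW** (the choice `λ = 2δ̄(1−κ)/κ`): steps `0 ≤ c_{k+1} − c_k ≤ δ̄`,
entropy contraction `0 < κ < 1`, `Λ ≥ 0` bounding the log-MGFs at `±2δ̄(1−κ)/κ` for the levels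
`j < n`: `|⟨W⟩ − ΔF − KL_qs| ≤ KL_qs + (κ/(1 − κ))·n·Λ`. [ours] -/
theorem abs_layerDissipation_sub_qs_le_entropy_anyGrid' (hP : ∀ k, IsRowStochastic (P k)) {δ : ℝ}
    (hδ : 0 < δ) (hc0 : ∀ k, 0 ≤ c (k + 1) - c k) (hc : ∀ k, c (k + 1) - c k ≤ δ)
    {κ : ℝ} (hκ0 : 0 < κ) (hκ1 : κ < 1)
    (hK : ∀ k (μ : X → ℝ), (∀ x, 0 ≤ μ x) → ∑ x, μ x = 1 →
      klFin (stepLaw (P k) μ) (gibbsLaw (linAction S₀ D (c (k + 1))))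
        ≤ (1 - κ) * klFin μ (gibbsLaw (linAction S₀ D (c (k + 1)))))
    {Λ : ℝ} (hΛ0 : 0 ≤ Λ) (n : ℕ)
    (hΛp : ∀ j, j < n → Real.log (∑ y, gibbsLaw (linAction S₀ D (c j)) y
        * Real.exp ((2 * δ * (1 - κ) / κ) * (D y - meanD S₀ D (c j)))) ≤ Λ)
    (hΛm : ∀ j, j < n → Real.log (∑ y, gibbsLaw (linAction S₀ D (c j)) y
        * Real.exp (-(2 * δ * (1 - κ) / κ) * (D y - meanD S₀ D (c j)))) ≤ Λ) :
    |layerDissipation S₀ D c P n - qsDissipation S₀ D c n|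
      ≤ qsDissipation S₀ D c n + κ / (1 - κ) * n * Λ := by
  have h1κ : 0 < 1 - κ := sub_pos.2 hκ1
  have hlam : 0 < 2 * δ * (1 - κ) / κ := div_pos (by positivity) hκ0
  have hu : δ / (2 * δ * (1 - κ) / κ) = κ / (2 * (1 - κ)) := by
    field_simp
  have hr : (1 - κ) * (1 + δ / (2 * δ * (1 - κ) / κ)) < 1 := by
    rw [hu]
    have : (1 - κ) * (1 + κ / (2 * (1 - κ))) = 1 - κ / 2 := by field_simp; ring
    rw [this]; linarith
  have key := abs_layerDissipation_sub_qs_le_entropy_anyGrid S₀ D c P hP hδ hc0 hc hκ1.le hK hlam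
    (Λ := fun _ => Λ) (fun _ => hΛ0) hr n hΛp hΛm
  rw [hu, sum_const, card_range, nsmul_eq_mul] at key
  have hden : 1 - (1 - κ) * (1 + κ / (2 * (1 - κ))) = κ / 2 := by field_simp; ring
  rw [hden] at key
  refine key.trans (le_of_eq ?_)
  field_simp
  ring

end Law

end Summit.Ventures.LatticeQCDFlow.Scaling
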